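import Summits.ResolutionOfSingularities.ResolutionOfSingularities.Theorems.PurelyInseparableDim4ChartAtlasSNCFarRepairReadingHeights
import HarnessLib

/-!
# Purely inseparable four-folds `z^p + F(x₁, …, x₄)`: THE POST-REPAIR READING AT ANY NUMBER OF HEIGHTS, WITH THE INACTIVE FAR QUADRICS — the
# second letter of the new node's dictionary (chart model; cell `res-dim4-pi`, typ-2 g8; HANDOFF g8 OPEN 1, kernel form of clause (b) of the
# §14(c) answer of 2026-08-29 14:14Z: «after repairing ALL active heights, a member meeting the new node reads a translated hyperplane or an
# inactive-index translated far quadric»)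

[OURS · counted 0] (D-0157 DOOR 2; DR-157-C.) p724360 `farRepair_chart_reading_heights` reads, after the one-step repair along `C(hs)`, the centre, the
state, the exceptional divisor and the HYPERPLANE members. Here the same induction is re-run with ONE MORE CLAUSE: a translated far quadric
`TQ_k(β, c′, e) = ((y_k + β)·y_j − c′·y_k + e)·𝒪` of NON-centre index `k ∉ T`, `k ≠ j`, with `c′ ∉ hs`, reads `TQ_k(β, c′ − h_last, e + β·h_last)` on the
final chart (it is never divided by an exceptional variable: `y_j ∤` at every stage because `c′` is not a repaired height). For the natural-frame members of
p720422 §1 (`c′ = 0`) the hypothesis is `0 ∉ hs` — true on `W` (heights are non-zero). PROVED here (no `sorry`, no new axiom):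

* `strictTransform_tquadric_inactive_height` — one height, general frame: `k ∉ T`, `k ≠ j`, `c′ ≠ h` ⟹ `TQ_k(β, c′, e)` reads `TQ_k(β, c′ − h, e + β·h)` on the
  `y_j`-chart of `τ ≫ ψ_{−h}` (p723327's `…inactive_height` is `c′ = 0`);
* **`farRepair_chart_reading_heights_tquadric`** (+ `_aux`) — p724360's eight clauses AND (9): `∀ k ∉ T, k ≠ j, ∀ β c′ e, c′ ∉ hs →` the reading of
  `St_τ TQ_k(β, c′, e)` on the chart `φ` is `TQ_k(β, c′ − out.1, e + β·out.1)`.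

So, with p723327/p725150 (resonant members leave) and p724360 (6)–(8): after the repair of ALL active heights the members of the natural-frame boundary that
still meet `St(Zc)` on its main chart are translated hyperplanes and inactive translated far quadrics — TWO LETTERS. Active NON-resonant members (excluded by
that policy) are the only ones outside. Nothing here is a statement about resolution of singularities in dimension ≥ 4 / characteristic `p` (NOT proved
anywhere in this programme). bears_on: LADDER-RESOLUTION:D157-DOOR2 (res-dim4-pi). Supports stmt-ResolutionOfSingularities-16155 (helper).
-/

-- every declaration of this summit lives under `Summit.ResolutionOfSingularities.ResolutionOfSingularities`
-- (summit = problem), which the duplicate-namespace linter flags; house convention (cf. the Target file).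
set_option linter.dupNamespace false

noncomputable section

open MvPolynomial CategoryTheory AlgebraicGeometry TopologicalSpace
open AlgebraicGeometry.Scheme.IdealSheafData (ofIdealTop)

namespace Summit.ResolutionOfSingularities.ResolutionOfSingularities.Theorems.PIDim4

open Literature.AlgebraicGeometry.Resolution
open Literature.AlgebraicGeometry.Resolution.Hauser2010
open Literature.AlgebraicGeometry.Resolution.AffinePointBlowup (P A γ coord)

namespace ChartDictionary

/-! ## §1 One height, general frame: the inactive far quadric -/

section OneHeight

variable {K : Type} [Field K] {T : Finset (Fin 4)} {j : Fin 4} {V' : Scheme.{0}} {τ : V' ⟶ P 4 K} {h : K}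

/-- **An inactive far quadric off the height is only translated**: `TQ_k(β, c′, e) = ((y_k + β)·y_j − c′·y_k + e)·𝒪` with `k ∉ T`, `k ≠ j`, `c′ ≠ h`
reads `TQ_k(β, c′ − h, e + β·h)` on the `y_j`-chart of `τ ≫ ψ_{−h}` (total transform; `y_j ∤` it because of the monomial `(h − c′)·y_k`). -/
theorem strictTransform_tquadric_inactive_height
    (hτ : IsBlowup τ ((AffineCoordBlowup.𝓘Λ 4 K (insert 0 (Fin.succ '' ((insert j T : Finset (Fin 4)) : Set (Fin 4))))).comap
      (Spec.map (CommRingCat.ofHom ((AffinePointBlowup.translateEquiv (n := 4) (Pi.single j.succ (-h)) : A 4 K ≃ₐ[K] A 4 K) :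
        A 4 K →+* A 4 K)))))
    {k : Fin 4} (hkT : k ∉ T) (hkj : k ≠ j) (β : K) {c' : K} (hch : c' ≠ h) (e : K) :
    (strictTransformIdeal τ ((AffineCoordBlowup.𝓘Λ 4 K (insert 0 (Fin.succ '' ((insert j T : Finset (Fin 4)) : Set (Fin 4))))).comap
        (Spec.map (CommRingCat.ofHom ((AffinePointBlowup.translateEquiv (n := 4) (Pi.single j.succ (-h)) : A 4 K ≃ₐ[K] A 4 K) :
          A 4 K →+* A 4 K)))) (ofIdealTop (Ideal.span {(γ 4 K).symm ((X k.succ + C β) * X j.succ - C c' * X k.succ + C e)}))).comap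
        (AffineCoordBlowup.chartImm (isBlowup_comp_spec_translate hτ) (succ_mem_centreVars (Finset.mem_insert_self j T))) =
      ofIdealTop (Ideal.span {(γ 4 K).symm ((X k.succ + C β) * X j.succ - C (c' - h) * X k.succ + C (e + β * h))}) := by
  classical
  have hk : k ∉ insert j T := fun hk => by
    rcases Finset.mem_insert.mp hk with e' | e'
    · exact hkj e'
    · exact hkT e'
  rw [strictTransformIdeal_height_principal, translateEquiv_single_tquadric (b := fun _ => β) (e := fun _ => e) (c' := c') h hkj]
  refine strictTransformIdeal_principal_comap_chartImm (Finset.mem_insert_self j T) 0 ?_ ?_ (isBlowup_comp_spec_translate hτ)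
  · have hkΛ : coordBlowupSubst K (insert 0 (Fin.succ '' ((insert j T : Finset (Fin 4)) : Set (Fin 4)))) j.succ (X k.succ : A 4 K) = X k.succ :=
      coordBlowupSubst_X_of_not_mem K _ j.succ (fun e' => hk ((succ_mem_centreVars_iff _ k).mp e'))
    rw [pow_zero, one_mul]
    simp only [map_add, map_sub, map_mul, coordBlowupSubst_C, coordBlowupSubst_X_self, hkΛ]
  · -- `y_j ∤`: the monomial `y_k` has coefficient `-(c′ - h) ≠ 0`
    refine not_coord_dvd_γ_symm_of_coeff (Finsupp.single k.succ 1) (Finsupp.single_eq_of_ne (fun e' => hkj (Fin.succ_injective _ e').symm)) ?_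
    have hjk' : j.succ ∉ (Finsupp.single k.succ 1).support := by
      rw [Finsupp.mem_support_iff, not_not]
      exact Finsupp.single_eq_of_ne (fun e' => hkj (Fin.succ_injective _ e').symm)
    rw [coeff_add, coeff_sub, coeff_mul_X', if_neg hjk', coeff_C_mul, coeff_X, if_pos rfl, coeff_C,
      if_neg (Finsupp.single_ne_zero.mpr one_ne_zero).symm, mul_one, zero_sub, add_zero, neg_ne_zero, sub_ne_zero]
    exact hch

end OneHeight

/-! ## §2 Any finite number of heights, with the inactive far quadrics -/

section Heights

variable {K : Type} [Field K] {p : ℕ} [hp : Fact p.Prime] [CharP K p] {T : Finset (Fin 4)} {j : Fin 4}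

/-- `farRepair_chart_reading_heights_tquadric` by induction on the number of heights (auxiliary form, length as a parameter). -/
theorem farRepair_chart_reading_heights_tquadric_aux [PerfectRing K p] [DecidableEq K] (hjT : j ∉ T) (n : ℕ) :
    ∀ (hs : List K), hs.length = n → hs ≠ [] → hs.Nodup → ∀ (F : MvPolynomial (Fin 4) K), (p : ℕ∞) ≤ CentreBlowup.ordAlong T F →
    ∀ {V' : Scheme.{0}} {τ : V' ⟶ P 4 K},
    IsBlowup τ (hs.map fun h => (AffineCoordBlowup.𝓘Λ 4 K (insert 0 (Fin.succ '' ((insert j T : Finset (Fin 4)) : Set (Fin 4))))).comap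
      (Spec.map (CommRingCat.ofHom ((AffinePointBlowup.translateEquiv (n := 4) (Pi.single j.succ (-h)) : A 4 K ≃ₐ[K] A 4 K) :
        A 4 K →+* A 4 K)))).prod →
    let Cm := (hs.map fun h => (AffineCoordBlowup.𝓘Λ 4 K (insert 0 (Fin.succ '' ((insert j T : Finset (Fin 4)) : Set (Fin 4))))).comap
      (Spec.map (CommRingCat.ofHom ((AffinePointBlowup.translateEquiv (n := 4) (Pi.single j.succ (-h)) : A 4 K ≃ₐ[K] A 4 K) :
        A 4 K →+* A 4 K)))).prod
    let out := hs.foldl (fun (acc : K × MvPolynomial (Fin 4) K) (h : K) =>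
      (h, (CentreBlowup.step p (insert j T) j 0 ⟨PointBlowup.translate (Pi.single j (h - acc.1)) acc.2, 0, ∅⟩).F)) (0, F)
    ∃ (φ : P 4 K ⟶ V') (_ : IsOpenImmersion φ),
      (strictTransformIdeal τ Cm (AffineCoordBlowup.𝓘Λ 4 K (insert 0 (Fin.succ '' (T : Set (Fin 4)))))).comap φ =
          AffineCoordBlowup.𝓘Λ 4 K (insert 0 (Fin.succ '' (T : Set (Fin 4)))) ∧
        ((strictTransformIdeal τ Cm (AffineCoordBlowup.𝓘Λ 4 K (insert 0 (Fin.succ '' (T : Set (Fin 4)))))).support : Set V') ⊆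
          Set.range φ ∧
        (controlledTransform τ Cm (hypSheaf p F) p).comap φ = hypSheaf p out.2 ∧
        (p : ℕ∞) ≤ CentreBlowup.ordAlong T out.2 ∧
        (Cm.comap τ).comap φ = (hs.map fun h => ofIdealTop (Ideal.span {(γ 4 K).symm (X j.succ + C (out.1 - h))})).prod ∧
        (∀ a : K, (strictTransformIdeal τ Cm (ofIdealTop (Ideal.span {(γ 4 K).symm (X j.succ + C a)}))).comap φ =
          if -a ∈ hs then ⊤ else ofIdealTop (Ideal.span {(γ 4 K).symm (X j.succ + C (a + out.1))})) ∧
        (∀ t ∈ T, (strictTransformIdeal τ Cm (ofIdealTop (Ideal.span {(γ 4 K).symm (X t.succ + C 0)}))).comap φ =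
          ofIdealTop (Ideal.span {(γ 4 K).symm (X t.succ + C 0)})) ∧
        (∀ i ∉ T, i ≠ j → ∀ a : K, (strictTransformIdeal τ Cm (ofIdealTop (Ideal.span {(γ 4 K).symm (X i.succ + C a)}))).comap φ =
          ofIdealTop (Ideal.span {(γ 4 K).symm (X i.succ + C a)})) ∧
        (∀ k ∉ T, k ≠ j → ∀ β c' e : K, c' ∉ hs →
          (strictTransformIdeal τ Cm (ofIdealTop (Ideal.span {(γ 4 K).symm ((X k.succ + C β) * X j.succ - C c' * X k.succ + C e)}))).comap φ =
            ofIdealTop (Ideal.span {(γ 4 K).symm ((X k.succ + C β) * X j.succ - C (c' - out.1) * X k.succ + C (e + β * out.1))})) := by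
  induction n with
  | zero => intro hs hlen hne; exact absurd (List.eq_nil_of_length_eq_zero hlen) hne
  | succ n ih =>
    intro hs hlen _ hnd F hperm V' τ hτ
    obtain _ | ⟨h, hs'⟩ := hs
    · exact absurd hlen (by simp)
    rw [List.length_cons, Nat.succ_inj] at hlen
    obtain ⟨hnh, hnd'⟩ := List.nodup_cons.mp hnd
    -- the one-height reading for the first factor
    have hs₁ : (⟨PointBlowup.translate (Pi.single j (h - 0)) F, 0, ∅⟩ : State K).F = PointBlowup.translate (Pi.single j h) F := by
      rw [sub_zero]
    simp only [List.map_cons, List.prod_cons, List.foldl_cons] at hτ ⊢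
    by_cases hnil : hs' = []
    · -- ONE HEIGHT: p723027 + p723327
      subst hnil
      simp only [List.map_nil, List.prod_nil, mul_one, List.foldl_nil] at hτ ⊢
      obtain ⟨Θ, g, hiso, h0, hs, hg, h1, h2, h3, h4, h5⟩ := farRepair_chart_reading hjT h F hperm _ hs₁ hτ
      haveI := hiso
      refine ⟨Spec.map (CommRingCat.ofHom (Θ : A 4 K →+* A 4 K)) ≫
        AffineCoordBlowup.chartImm (isBlowup_comp_spec_translate hτ) (succ_mem_centreVars (Finset.mem_insert_self j T)),
        inferInstance, h1, h2, h3, h5, ?_, fun a => ?_, fun t ht => ?_, fun i hiT hij a => ?_, fun k hkT hkj β c' e hc' => ?_⟩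
      · rw [h4, sub_self]
      · by_cases ha : -a = h
        · have ha' : a + h = 0 := by rw [← ha, add_neg_cancel]
          rw [if_pos (List.mem_singleton.mpr ha), Scheme.IdealSheafData.comap_comp, strictTransform_hyperplane_j_height_self hτ ha',
            Scheme.IdealSheafData.comap_top]
        · have ha' : a + h ≠ 0 := fun e => ha (by rw [← neg_eq_iff_add_eq_zero] at e; exact e.symm ▸ rfl)
          rw [if_neg (fun hm => ha (List.mem_singleton.mp hm)), Scheme.IdealSheafData.comap_comp,
            strictTransform_hyperplane_j_height_of_ne hτ ha']
          exact comap_specMap_principal_of_fix Θ (by rw [map_add, hs j, show Θ (C (a + h)) = C (a + h) from Θ.commutes _])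
      · rw [Scheme.IdealSheafData.comap_comp, strictTransform_hyperplane_centreVar_height hτ ht hjT]
        exact comap_specMap_principal_of_fix Θ (by rw [map_add, hs t, show Θ (C (0 : K)) = C 0 from Θ.commutes _])
      · rw [Scheme.IdealSheafData.comap_comp, strictTransform_hyperplane_transversal_height hτ hiT hij a]
        exact comap_specMap_principal_of_fix Θ (by rw [map_add, hs i, show Θ (C a) = C a from Θ.commutes _])
      · have hch : c' ≠ h := fun e' => hc' (List.mem_singleton.mpr e')
        rw [Scheme.IdealSheafData.comap_comp, strictTransform_tquadric_inactive_height hτ hkT hkj β hch e]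
        exact comap_specMap_principal_of_fix Θ (by
          simp only [map_add, map_sub, map_mul, hs k, hs j, show ∀ a : K, Θ (C a) = C a from fun a => Θ.commutes a])
    · -- SEVERAL HEIGHTS: factor, read the first repair, restrict the rest over its chart, induct
      set Λ : Set (Fin (4 + 1)) := insert 0 (Fin.succ '' ((insert j T : Finset (Fin 4)) : Set (Fin 4))) with hΛ
      set Cf : K → Scheme.IdealSheafData (P 4 K) := fun h => (AffineCoordBlowup.𝓘Λ 4 K Λ).comap
        (Spec.map (CommRingCat.ofHom ((AffinePointBlowup.translateEquiv (n := 4) (Pi.single j.succ (-h)) : A 4 K ≃ₐ[K] A 4 K) :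
          A 4 K →+* A 4 K))) with hCf
      have hdisj : Disjoint ((Cf h).support : Set (P 4 K)) ((hs'.map Cf).prod.support : Set (P 4 K)) := disjoint_support_heights hnh
      -- factor `τ = τ₂ ≫ τ₁`
      obtain ⟨X₁, τ₁, τ₂, hτ₁, hτ₂, rfl⟩ := hτ.exists_comp_eq_of_mul
      haveI : IsLocallyNoetherian X₁ := hτ₁.isLocallyNoetherian
      haveI : IsLocallyNoetherian V' := hτ₂.isLocallyNoetherian
      -- the first repair, read on its chart
      obtain ⟨Θ, g, hiso, h0, hs, hg, h1, h2, h3, h4, h5⟩ := farRepair_chart_reading hjT h F hperm _ hs₁ hτ₁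
      haveI := hiso
      set φ₁ := Spec.map (CommRingCat.ofHom (Θ : A 4 K →+* A 4 K)) ≫
        AffineCoordBlowup.chartImm (isBlowup_comp_spec_translate hτ₁) (succ_mem_centreVars (Finset.mem_insert_self j T)) with hφ₁
      haveI : IsOpenImmersion φ₁ := inferInstanceAs (IsOpenImmersion (Spec.map (CommRingCat.ofHom (Θ : A 4 K →+* A 4 K)) ≫
        AffineCoordBlowup.chartImm (isBlowup_comp_spec_translate hτ₁) (succ_mem_centreVars (Finset.mem_insert_self j T))))
      -- the remaining centre on that chart: the shifted heights
      have hX : (((hs'.map Cf).prod).comap τ₁).comap φ₁ = ((hs'.map fun h' => h' - h).map Cf).prod := by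
        rw [hφ₁, hCf]
        exact comap_chart_heightLoci hjT h0 hs hg hnh hτ₁
      -- the rest of the repair, restricted over the chart, is the same repair at the shifted heights
      have hτ₂' := isBlowup_morphismRestrict_comp_isoOpensRange_inv φ₁ hτ₂
      rw [hX] at hτ₂'
      have hne' : (hs'.map fun h' => h' - h) ≠ [] := fun e => hnil (List.map_eq_nil_iff.mp e)
      have hnd'' : (hs'.map fun h' => h' - h).Nodup := hnd'.map (sub_left_injective)
      obtain ⟨φ₂, hφ₂, g1, g2, g3, g4, g5, g6, g7, g8, g9⟩ := ih _ (by rw [List.length_map, hlen]) hne' hnd'' _ h5 hτ₂'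
      -- the fold at the shifted heights
      have hfold := foldl_heightStates_shift (α := MvPolynomial (Fin 4) K)
        (fun (d : K) (G : MvPolynomial (Fin 4) K) => (CentreBlowup.step p (insert j T) j 0 ⟨PointBlowup.translate (Pi.single j d) G, 0, ∅⟩).F)
        hs' h h (CentreBlowup.step p (insert j T) j 0 ⟨PointBlowup.translate (Pi.single j (h - 0)) F, 0, ∅⟩).F
      rw [sub_self] at hfold
      simp only [hfold] at g3 g4 g5 g6 g9
      -- the chart of the repaired centre after the whole repair
      refine ⟨φ₂ ≫ (τ₂ ⁻¹ᵁ φ₁.opensRange).ι, inferInstance, ?_, ?_, ?_, g4, ?_, fun a => ?_, fun t ht => ?_, fun i hiT hij a => ?_,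
        fun k hkT hkj β c' e hc' => ?_⟩
      · -- (1) the strict transform of the escaping centre
        rw [IsBlowup.strictTransformIdeal_comp_of_disjoint hτ₂ hdisj, Scheme.IdealSheafData.comap_comp, ← strictTransformIdeal_model φ₁, hX,
          h1]
        exact g1
      · -- (2) single chart
        intro x hx
        rw [IsBlowup.strictTransformIdeal_comp_of_disjoint hτ₂ hdisj] at hx
        have hx₁ : τ₂ x ∈ φ₁.opensRange := by
          have h' := h2 (mem_support_of_mem_support_strictTransformIdeal hx)
          rwa [← Scheme.Hom.coe_opensRange] at h'
        obtain ⟨x', rfl⟩ : x ∈ Set.range (τ₂ ⁻¹ᵁ φ₁.opensRange).ι := by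
          rw [Scheme.Opens.range_ι]
          exact hx₁
        have hx' : x' ∈ ((strictTransformIdeal ((τ₂ ∣_ φ₁.opensRange) ≫ φ₁.isoOpensRange.inv) (((hs'.map Cf).prod.comap τ₁).comap φ₁)
            ((strictTransformIdeal τ₁ (Cf h) (AffineCoordBlowup.𝓘Λ 4 K (insert 0 (Fin.succ '' (T : Set (Fin 4)))))).comap φ₁)).support :
            Set _) := by
          rw [strictTransformIdeal_model φ₁]
          exact (mem_support_comap_iff _ _ x').mpr hx
        rw [hX, h1] at hx'
        obtain ⟨y, rfl⟩ := g2 hx'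
        exact ⟨y, rfl⟩
      · -- (3) the controlled transform
        rw [IsBlowup.controlledTransform_comp_of_disjoint hτ₁ hτ₂ hdisj, Scheme.IdealSheafData.comap_comp, ← controlledTransform_model φ₁, hX, h3]
        exact g3
      · -- (5) the exceptional ideal
        rw [comap_mul_comp, comap_mul]
        congr 1
        · rw [← IsBlowup.strictTransformIdeal_comap_fst_of_disjoint hτ₂ hdisj, Scheme.IdealSheafData.comap_comp, ← strictTransformIdeal_model φ₁,
            hX, h4, g6 0]
          have h0ni : ¬ (-(0 : K)) ∈ hs'.map (fun h' => h' - h) := by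
            rw [neg_zero, List.mem_map]
            rintro ⟨h', hh', e⟩
            exact hnh (sub_eq_zero.mp e ▸ hh')
          rw [if_neg h0ni, zero_add]
        · rw [Scheme.IdealSheafData.comap_comp, ← comap_centre_model φ₁, hX, g5, List.map_map]
          congr 1
          refine List.map_congr_left fun h' _ => ?_
          simp only [Function.comp_apply, sub_sub_sub_cancel_right]
      · -- (6) index-`j` hyperplanes
        rw [IsBlowup.strictTransformIdeal_comp_of_disjoint hτ₂ hdisj, Scheme.IdealSheafData.comap_comp, ← strictTransformIdeal_model φ₁, hX]
        by_cases ha : a + h = 0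
        · have ham : -a ∈ h :: hs' := List.mem_cons.mpr (Or.inl (neg_eq_of_add_eq_zero_left ((add_comm h a).trans ha)))
          have e6 : (strictTransformIdeal τ₁ (Cf h) (ofIdealTop (Ideal.span {(γ 4 K).symm (X j.succ + C a)}))).comap φ₁ = ⊤ := by
            rw [hφ₁, Scheme.IdealSheafData.comap_comp, hCf, strictTransform_hyperplane_j_height_self hτ₁ ha, Scheme.IdealSheafData.comap_top]
          rw [if_pos ham, e6, strictTransformIdeal_top, Scheme.IdealSheafData.comap_top]
        · have e6 : (strictTransformIdeal τ₁ (Cf h) (ofIdealTop (Ideal.span {(γ 4 K).symm (X j.succ + C a)}))).comap φ₁ =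
              ofIdealTop (Ideal.span {(γ 4 K).symm (X j.succ + C (a + h))}) := by
            rw [hφ₁, Scheme.IdealSheafData.comap_comp, hCf, strictTransform_hyperplane_j_height_of_ne hτ₁ ha]
            exact comap_specMap_principal_of_fix Θ (by rw [map_add, hs j, show Θ (C (a + h)) = C (a + h) from Θ.commutes _])
          rw [e6, g6 (a + h)]
          have hiff : (-(a + h)) ∈ hs'.map (fun h' => h' - h) ↔ -a ∈ hs' := by
            rw [List.mem_map]
            constructor
            · rintro ⟨h', hh', e⟩
              have : h' = -a := by linear_combination e
              exact this ▸ hh'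
            · intro hm
              exact ⟨-a, hm, by ring⟩
          have hah : -a ≠ h := fun e => ha (by rw [← e, add_neg_cancel])
          by_cases hm : -a ∈ hs'
          · rw [if_pos (hiff.mpr hm), if_pos (List.mem_cons.mpr (Or.inr hm))]
          · rw [if_neg (fun hm' => hm (hiff.mp hm')), if_neg (fun hm' => (List.mem_cons.mp hm').elim hah hm), add_assoc, add_sub_cancel]
      · -- (7) near members
        have e7 : (strictTransformIdeal τ₁ (Cf h) (ofIdealTop (Ideal.span {(γ 4 K).symm (X t.succ + C 0)}))).comap φ₁ =
            ofIdealTop (Ideal.span {(γ 4 K).symm (X t.succ + C 0)}) := by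
          rw [hφ₁, Scheme.IdealSheafData.comap_comp, hCf, strictTransform_hyperplane_centreVar_height hτ₁ ht hjT]
          exact comap_specMap_principal_of_fix Θ (by rw [map_add, hs t, show Θ (C (0 : K)) = C 0 from Θ.commutes _])
        rw [IsBlowup.strictTransformIdeal_comp_of_disjoint hτ₂ hdisj, Scheme.IdealSheafData.comap_comp, ← strictTransformIdeal_model φ₁, hX, e7]
        exact g7 t ht
      · -- (8) transversal members
        have e8 : (strictTransformIdeal τ₁ (Cf h) (ofIdealTop (Ideal.span {(γ 4 K).symm (X i.succ + C a)}))).comap φ₁ =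
            ofIdealTop (Ideal.span {(γ 4 K).symm (X i.succ + C a)}) := by
          rw [hφ₁, Scheme.IdealSheafData.comap_comp, hCf, strictTransform_hyperplane_transversal_height hτ₁ hiT hij a]
          exact comap_specMap_principal_of_fix Θ (by rw [map_add, hs i, show Θ (C a) = C a from Θ.commutes _])
        rw [IsBlowup.strictTransformIdeal_comp_of_disjoint hτ₂ hdisj, Scheme.IdealSheafData.comap_comp, ← strictTransformIdeal_model φ₁, hX, e8]
        exact g8 i hiT hij a
      · -- (9) inactive far quadrics
        have hch : c' ≠ h := fun e' => hc' (List.mem_cons.mpr (Or.inl e'))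
        have hc'' : c' - h ∉ hs'.map (fun h' => h' - h) := fun hm => by
          obtain ⟨h', hh', e'⟩ := List.mem_map.mp hm
          exact hc' (List.mem_cons.mpr (Or.inr ((sub_left_injective e') ▸ hh')))
        have e9 : (strictTransformIdeal τ₁ (Cf h) (ofIdealTop (Ideal.span {(γ 4 K).symm
            ((X k.succ + C β) * X j.succ - C c' * X k.succ + C e)}))).comap φ₁ =
            ofIdealTop (Ideal.span {(γ 4 K).symm ((X k.succ + C β) * X j.succ - C (c' - h) * X k.succ + C (e + β * h))}) := by
          rw [hφ₁, Scheme.IdealSheafData.comap_comp, hCf, strictTransform_tquadric_inactive_height hτ₁ hkT hkj β hch e]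
          exact comap_specMap_principal_of_fix Θ (by
            simp only [map_add, map_sub, map_mul, hs k, hs j, show ∀ a : K, Θ (C a) = C a from fun a => Θ.commutes a])
        rw [IsBlowup.strictTransformIdeal_comp_of_disjoint hτ₂ hdisj, Scheme.IdealSheafData.comap_comp, ← strictTransformIdeal_model φ₁, hX, e9,
          g9 k hkT hkj β (c' - h) (e + β * h) hc'']
        congr 4
        all_goals ring

/-- **THE POST-REPAIR READING AT ANY FINITE NUMBER OF HEIGHTS, WITH THE INACTIVE FAR QUADRICS** (chart model; nine clauses). -/
theorem farRepair_chart_reading_heights_tquadric [PerfectRing K p] [DecidableEq K] (hjT : j ∉ T) :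
    ∀ (hs : List K), hs ≠ [] → hs.Nodup → ∀ (F : MvPolynomial (Fin 4) K), (p : ℕ∞) ≤ CentreBlowup.ordAlong T F →
    ∀ {V' : Scheme.{0}} {τ : V' ⟶ P 4 K},
    IsBlowup τ (hs.map fun h => (AffineCoordBlowup.𝓘Λ 4 K (insert 0 (Fin.succ '' ((insert j T : Finset (Fin 4)) : Set (Fin 4))))).comap
      (Spec.map (CommRingCat.ofHom ((AffinePointBlowup.translateEquiv (n := 4) (Pi.single j.succ (-h)) : A 4 K ≃ₐ[K] A 4 K) :
        A 4 K →+* A 4 K)))).prod →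
    let Cm := (hs.map fun h => (AffineCoordBlowup.𝓘Λ 4 K (insert 0 (Fin.succ '' ((insert j T : Finset (Fin 4)) : Set (Fin 4))))).comap
      (Spec.map (CommRingCat.ofHom ((AffinePointBlowup.translateEquiv (n := 4) (Pi.single j.succ (-h)) : A 4 K ≃ₐ[K] A 4 K) :
        A 4 K →+* A 4 K)))).prod
    let out := hs.foldl (fun (acc : K × MvPolynomial (Fin 4) K) (h : K) =>
      (h, (CentreBlowup.step p (insert j T) j 0 ⟨PointBlowup.translate (Pi.single j (h - acc.1)) acc.2, 0, ∅⟩).F)) (0, F)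
    ∃ (φ : P 4 K ⟶ V') (_ : IsOpenImmersion φ),
      (strictTransformIdeal τ Cm (AffineCoordBlowup.𝓘Λ 4 K (insert 0 (Fin.succ '' (T : Set (Fin 4)))))).comap φ =
          AffineCoordBlowup.𝓘Λ 4 K (insert 0 (Fin.succ '' (T : Set (Fin 4)))) ∧
        ((strictTransformIdeal τ Cm (AffineCoordBlowup.𝓘Λ 4 K (insert 0 (Fin.succ '' (T : Set (Fin 4)))))).support : Set V') ⊆
          Set.range φ ∧
        (controlledTransform τ Cm (hypSheaf p F) p).comap φ = hypSheaf p out.2 ∧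
        (p : ℕ∞) ≤ CentreBlowup.ordAlong T out.2 ∧
        (Cm.comap τ).comap φ = (hs.map fun h => ofIdealTop (Ideal.span {(γ 4 K).symm (X j.succ + C (out.1 - h))})).prod ∧
        (∀ a : K, (strictTransformIdeal τ Cm (ofIdealTop (Ideal.span {(γ 4 K).symm (X j.succ + C a)}))).comap φ =
          if -a ∈ hs then ⊤ else ofIdealTop (Ideal.span {(γ 4 K).symm (X j.succ + C (a + out.1))})) ∧
        (∀ t ∈ T, (strictTransformIdeal τ Cm (ofIdealTop (Ideal.span {(γ 4 K).symm (X t.succ + C 0)}))).comap φ =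
          ofIdealTop (Ideal.span {(γ 4 K).symm (X t.succ + C 0)})) ∧
        (∀ i ∉ T, i ≠ j → ∀ a : K, (strictTransformIdeal τ Cm (ofIdealTop (Ideal.span {(γ 4 K).symm (X i.succ + C a)}))).comap φ =
          ofIdealTop (Ideal.span {(γ 4 K).symm (X i.succ + C a)})) ∧
        (∀ k ∉ T, k ≠ j → ∀ β c' e : K, c' ∉ hs →
          (strictTransformIdeal τ Cm (ofIdealTop (Ideal.span {(γ 4 K).symm ((X k.succ + C β) * X j.succ - C c' * X k.succ + C e)}))).comap φ =
            ofIdealTop (Ideal.span {(γ 4 K).symm ((X k.succ + C β) * X j.succ - C (c' - out.1) * X k.succ + C (e + β * out.1))})) := by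
  intro hs
  exact farRepair_chart_reading_heights_tquadric_aux hjT hs.length hs rfl

end Heights

end ChartDictionary

end Summit.ResolutionOfSingularities.ResolutionOfSingularities.Theorems.PIDim4

end
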